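import Literature.Analysis.FunctionSpaces.PolchinskiLogSobolevGradient
import Mathlib.Analysis.Calculus.BumpFunction.Convolution
import Mathlib.Analysis.Calculus.BumpFunction.InnerProduct
import Mathlib.Analysis.Calculus.ContDiff.Convolution
import Mathlib.MeasureTheory.Measure.Haar.InnerProductSpace
import HarnessLib

/-!
# The multiscale Bakry–Émery criterion in log-Sobolev form for `C¹` test functions with compact
# support (Bauerschmidt–Bodineau–Dagallier, Theorem 3, (e:LSI) on the class `C¹_c`)

Topic `Literature/Analysis/FunctionSpaces`; companion of `PolchinskiLogSobolevGradient.lean`.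

`PolchinskiLogSobolevGradient.lean` proves (e:LSI) of [BBD] Theorem 3,
`Ent_{ν₀}(f²) ≤ 2(∫₀^∞ e^{−2λ_t}dt)·E_{ν₀}[⟨∇f, Ċ₀∇f⟩]`, for `V₀ ∈ C_b⁴` and SMOOTH compactly supported
`f` (`logSobolev_of_multiscaleBakryEmery`).  The tree's named fact
`BauerschmidtBodineau_multiscaleBakryEmery` is typed on the test class `f ∈ C¹_c(ℝ^N)` (the class of
`UniformlyConvexLogSobolevDomain.HasLogSobolevC1c`, Bakry–Gentil–Ledoux Def. 5.1.1).  This file performs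
the routine density passage `C_c^∞ → C¹_c`: mollify `f` by a shrinking family of normed bump functions
`ρ_n ⋆ f` (Mathlib `ContDiffBump.normed`, `MeasureTheory.convolution`), apply the smooth theorem to each
`ρ_n ⋆ f ∈ C_c^∞`, and pass to the limit by dominated convergence on both sides: `ρ_n ⋆ f → f` and
`∇(ρ_n ⋆ f) = ρ_n ⋆ ∇f → ∇f` pointwise (`HasCompactSupport.hasFDerivAt_convolution_right`,
`ContDiffBump.convolution_tendsto_right_of_continuous`) with uniform bounds (`f`, `∇f` bounded,
`ν₀` a probability measure).  Standard real analysis; [BBD] state Theorem 3 for «`F : X → ℝ`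
with values in a compact interval» without a regularity discussion (p0016 L43), and the `C¹_c` class is
the conventional domain of (e:LSI).

## Main result (sorry-free; no new definitions, no new named facts)

* **`logSobolev_of_multiscaleBakryEmery_of_contDiff_one`** — (e:LSI) of [BBD] Theorem 3 for every
  `f ∈ C¹(ℝ^N)` with compact support, `V₀ ∈ C_b⁴`, under (e:continuity) and (e:assCt-mon).

After this file the named fact `BauerschmidtBodineau_multiscaleBakryEmery` and the proved theorem have the
SAME test class and conclusion; they differ only in the hypotheses on `V₀` (measurable bounded below with
`V_t ∈ C²`, versus `C_b⁴`) — which is where the fact's typing exceeds the printed proof.  Not a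
discharge of the named fact.  No claim about Yang–Mills is made (no gauge instance of (e:assCt-mon) exists
in print; the Clay problem is untouched; in this programme the criterion bears only on the conditional
rung `BalabanLadder.UV`).

## References

* [BauerschmidtBodineauDagallier2023] R. Bauerschmidt, T. Bodineau, B. Dagallier, Probab. Surveys 21
  (2024) 200–290, arXiv:2307.07619 — Theorem 3 p0015 L62–90 ((e:LSI)), p0016 L40–45. READ (held text).
-/

noncomputable section

set_option maxSynthPendingDepth 3

open MeasureTheory ProbabilityTheory Filter Topology Set
open scoped RealInnerProductSpace Matrix MatrixOrder ContDiff Gradient Convolution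

namespace Literature.Analysis.FunctionSpaces

namespace Polchinski

variable {N : ℕ}

section Helpers

/-- `⟪v, Ċ v⟫ = Σ_{kl} Ċ_{kl} v_k v_l` on `EuclideanSpace`. [folklore] -/
private theorem inner_toEuclideanLin_self' (C : Matrix (Fin N) (Fin N) ℝ)
    (v : EuclideanSpace ℝ (Fin N)) :
    ⟪v, Matrix.toEuclideanLin C v⟫ = ∑ k, ∑ l, C k l * (v k * v l) := by
  rw [EuclideanSpace.inner_eq_star_dotProduct, star_trivial]
  show (C *ᵥ WithLp.ofLp v) ⬝ᵥ WithLp.ofLp v = _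
  simp only [dotProduct, Matrix.mulVec, Finset.sum_mul]
  exact Finset.sum_congr rfl fun k _ => Finset.sum_congr rfl fun l _ => by ring

/-- Coordinates of the gradient: `(∇f)_k = ∂_k f`. [folklore] -/
private theorem gradient_apply_single' (f : EuclideanSpace ℝ (Fin N) → ℝ)
    (φ : EuclideanSpace ℝ (Fin N)) (k : Fin N) :
    (gradient f φ) k = fderiv ℝ f φ (EuclideanSpace.single k 1) := by
  have h := EuclideanSpace.inner_single_right k (1 : ℝ) (gradient f φ)
  simp only [one_mul, RCLike.conj_to_real] at h
  rw [← h, inner_gradient_left]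

end Helpers

section Main

variable (D : CovDecomposition N) {V₀ : EuclideanSpace ℝ (Fin N) → ℝ} {BV : ℝ}

set_option maxHeartbeats 800000 in
/-- **[BBD] Theorem 3 in log-Sobolev form (e:LSI) on the test class `C¹_c`, proved for `V₀ ∈ C_b⁴`.**
Under the hypotheses of `entropy_le_of_multiscaleBakryEmery` on `(C_t)`, `V₀`, (e:continuity),
(e:assCt-mon), `λ`: for every `f ∈ C¹(ℝ^N)` with compact support,
`E_{ν₀}[f² log f²] − E_{ν₀}[f²] log E_{ν₀}[f²] ≤ 2(∫₀^∞ e^{−2λ_t}dt)·E_{ν₀}[⟨∇f, Ċ_0 ∇f⟩]`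
(from `logSobolev_of_multiscaleBakryEmery` for the mollifications `ρ_n ⋆ f ∈ C_c^∞`, `n → ∞`, by
dominated convergence).  Same test class and conclusion as the named fact
`BauerschmidtBodineau_multiscaleBakryEmery`, for the regularity class `V₀ ∈ C_b⁴` only; not a discharge
of it; no Yang–Mills content. [cite: BauerschmidtBodineauDagallier2023, Theorem 3] -/
theorem logSobolev_of_multiscaleBakryEmery_of_contDiff_one
    (hV : ContDiff ℝ 4 V₀) (hVB : ∀ n ≤ 4, ∀ x, ‖iteratedFDeriv ℝ n V₀ x‖ ≤ BV)
    (hCA : ContinuityAssumption D V₀) {lamdot lam : ℝ → ℝ} (hMS : MultiscaleCondition D V₀ lamdot)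
    (hli : ∀ t, 0 ≤ t → IntervalIntegrable lamdot volume 0 t)
    (hlam : ∀ t, 0 ≤ t → lam t = ∫ s in (0 : ℝ)..t, lamdot s)
    (hexp : IntegrableOn (fun t => Real.exp (-2 * lam t)) (Ioi 0))
    (f : EuclideanSpace ℝ (Fin N) → ℝ) (hf : ContDiff ℝ 1 f) (hfc : HasCompactSupport f) :
    ∫ φ, f φ ^ 2 * Real.log (f φ ^ 2) ∂(nu0 D V₀) -
        (∫ φ, f φ ^ 2 ∂(nu0 D V₀)) * Real.log (∫ φ, f φ ^ 2 ∂(nu0 D V₀)) ≤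
      2 * (∫ t in Ioi (0 : ℝ), Real.exp (-2 * lam t)) *
        ∫ φ, ⟪gradient f φ, Matrix.toEuclideanLin (D.Cdot 0) (gradient f φ)⟫ ∂(nu0 D V₀) := by
  classical
  ---------------------------------------------------------------- the measure
  have hVabs : ∀ x, |V₀ x| ≤ BV := Cb4.abs_le hVB
  have hb : ∀ φ, -BV ≤ V₀ φ := fun φ => (abs_le.1 (hVabs φ)).1
  have hVm : Measurable V₀ := hV.continuous.measurable
  haveI := isProbabilityMeasure_nu0 D hVm hb
  set ν := nu0 D V₀ with hν
  set I : ℝ := ∫ t in Ioi (0 : ℝ), Real.exp (-2 * lam t) with hI_def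
  ---------------------------------------------------------------- bounds on `f`, `∇f`
  have hfcont : Continuous f := hf.continuous
  have hdfcont : Continuous (fderiv ℝ f) := hf.continuous_fderiv one_ne_zero
  have hdfc : HasCompactSupport (fderiv ℝ f) := hfc.fderiv (𝕜 := ℝ)
  obtain ⟨Bf, hBf⟩ : ∃ B, ∀ x, ‖f x‖ ≤ B := hfcont.bounded_above_of_compact_support hfc
  obtain ⟨Bd, hBd⟩ : ∃ B, ∀ x, ‖fderiv ℝ f x‖ ≤ B := hdfcont.bounded_above_of_compact_support hdfc
  have hBf0 : 0 ≤ Bf := (norm_nonneg _).trans (hBf 0)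
  have hBd0 : 0 ≤ Bd := (norm_nonneg _).trans (hBd 0)
  have hdfk : ∀ x (k : Fin N), |fderiv ℝ f x (EuclideanSpace.single k 1)| ≤ Bd := fun x k => by
    have h := (fderiv ℝ f x).le_opNorm (EuclideanSpace.single k 1)
    rw [Cb4.norm_single_one, mul_one] at h
    exact (Real.norm_eq_abs _ ▸ h).trans (hBd x)
  ---------------------------------------------------------------- the mollifiers
  let ρ : ℕ → ContDiffBump (0 : EuclideanSpace ℝ (Fin N)) := fun n =>
    ⟨1 / ((n : ℝ) + 2), 1 / ((n : ℝ) + 1), by positivity,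
      one_div_lt_one_div_of_lt (by positivity) (by linarith)⟩
  have hρ : Tendsto (fun n => (ρ n).rOut) atTop (𝓝 0) := by
    show Tendsto (fun n : ℕ => 1 / ((n : ℝ) + 1)) atTop (𝓝 0)
    exact tendsto_one_div_add_atTop_nhds_zero_nat
  have hρli : ∀ n, LocallyIntegrable ((ρ n).normed volume) volume := fun n =>
    (ρ n).continuous_normed.locallyIntegrable
  let g : ℕ → EuclideanSpace ℝ (Fin N) → ℝ := fun n =>
    (ρ n).normed volume ⋆[ContinuousLinearMap.lsmul ℝ ℝ, volume] f
  have hgs : ∀ n, ContDiff ℝ ∞ (g n) := fun n =>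
    (ρ n).hasCompactSupport_normed.contDiff_convolution_left _ (ρ n).contDiff_normed
      hfcont.locallyIntegrable
  have hgc : ∀ n, HasCompactSupport (g n) := fun n =>
    (ρ n).hasCompactSupport_normed.convolution _ hfc
  -- the smooth theorem for each mollification
  have hstep : ∀ n,
      ∫ φ, g n φ ^ 2 * Real.log (g n φ ^ 2) ∂ν - (∫ φ, g n φ ^ 2 ∂ν) * Real.log (∫ φ, g n φ ^ 2 ∂ν) ≤
        2 * I * ∫ φ, ⟪gradient (g n) φ, Matrix.toEuclideanLin (D.Cdot 0) (gradient (g n) φ)⟫ ∂ν :=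
    fun n => logSobolev_of_multiscaleBakryEmery D hV hVB hCA hMS hli hlam hexp (g n) (hgs n) (hgc n)
  ---------------------------------------------------------------- pointwise convergence
  have hg_tend : ∀ x, Tendsto (fun n => g n x) atTop (𝓝 (f x)) := fun x =>
    ContDiffBump.convolution_tendsto_right_of_continuous hρ hfcont x
  have hdg : ∀ n x, HasFDerivAt (g n)
      (((ρ n).normed volume ⋆[(ContinuousLinearMap.lsmul ℝ ℝ).precompR (EuclideanSpace ℝ (Fin N)),
        volume] fderiv ℝ f) x) x :=
    fun n x => hfc.hasFDerivAt_convolution_right _ (hρli n) hf x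
  have hdg_apply : ∀ n x (v : EuclideanSpace ℝ (Fin N)), fderiv ℝ (g n) x v =
      ((ρ n).normed volume ⋆[ContinuousLinearMap.lsmul ℝ ℝ, volume] fun a => fderiv ℝ f a v) x := by
    intro n x v
    rw [(hdg n x).fderiv, convolution_precompR_apply _ (hρli n) hdfc hdfcont]
  have hdfv : ∀ v : EuclideanSpace ℝ (Fin N), Continuous fun a => fderiv ℝ f a v := fun v =>
    (ContinuousLinearMap.apply ℝ ℝ v).continuous.comp hdfcont
  have hdg_tend : ∀ x (v : EuclideanSpace ℝ (Fin N)),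
      Tendsto (fun n => fderiv ℝ (g n) x v) atTop (𝓝 (fderiv ℝ f x v)) := by
    intro x v
    simp only [hdg_apply]
    exact ContDiffBump.convolution_tendsto_right_of_continuous hρ (hdfv v) x
  ---------------------------------------------------------------- uniform bounds
  have hg_bd : ∀ n x, |g n x| ≤ 3 * Bf := by
    intro n x
    have h : dist (g n x) (f x) ≤ 2 * Bf := by
      refine (ρ n).dist_normed_convolution_le hfcont.aestronglyMeasurable fun y _ => ?_
      rw [dist_eq_norm]
      exact (norm_sub_le _ _).trans (by linarith [hBf y, hBf x])
    rw [Real.dist_eq] at h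
    have hx : |f x| ≤ Bf := Real.norm_eq_abs _ ▸ hBf x
    calc |g n x| = |(g n x - f x) + f x| := by ring_nf
      _ ≤ |g n x - f x| + |f x| := abs_add_le _ _
      _ ≤ 3 * Bf := by linarith
  have hdg_bd : ∀ n x (k : Fin N), |fderiv ℝ (g n) x (EuclideanSpace.single k 1)| ≤ 3 * Bd := by
    intro n x k
    rw [hdg_apply]
    have h : dist (((ρ n).normed volume ⋆[ContinuousLinearMap.lsmul ℝ ℝ, volume] fun a =>
        fderiv ℝ f a (EuclideanSpace.single k 1)) x) (fderiv ℝ f x (EuclideanSpace.single k 1)) ≤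
        2 * Bd := by
      refine (ρ n).dist_normed_convolution_le (hdfv _).aestronglyMeasurable fun y _ => ?_
      rw [Real.dist_eq]
      exact (abs_sub _ _).trans (by linarith [hdfk y k, hdfk x k])
    rw [Real.dist_eq] at h
    have hx := hdfk x k
    calc |((ρ n).normed volume ⋆[ContinuousLinearMap.lsmul ℝ ℝ, volume] fun a =>
            fderiv ℝ f a (EuclideanSpace.single k 1)) x|
        ≤ |((ρ n).normed volume ⋆[ContinuousLinearMap.lsmul ℝ ℝ, volume] fun a =>
            fderiv ℝ f a (EuclideanSpace.single k 1)) x - fderiv ℝ f x (EuclideanSpace.single k 1)| +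
          |fderiv ℝ f x (EuclideanSpace.single k 1)| := by
          have := abs_add_le (((ρ n).normed volume ⋆[ContinuousLinearMap.lsmul ℝ ℝ, volume] fun a =>
            fderiv ℝ f a (EuclideanSpace.single k 1)) x - fderiv ℝ f x (EuclideanSpace.single k 1))
            (fderiv ℝ f x (EuclideanSpace.single k 1))
          simpa using this
      _ ≤ 3 * Bd := by linarith
  ---------------------------------------------------------------- the entropy side
  have hf2le : ∀ x, f x ^ 2 ≤ Bf ^ 2 := fun x => by
    have hx : |f x| ≤ Bf := Real.norm_eq_abs _ ▸ hBf x
    rw [← sq_abs]; exact pow_le_pow_left₀ (abs_nonneg _) hx 2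
  have hg2le : ∀ n x, g n x ^ 2 ≤ (3 * Bf) ^ 2 := fun n x => by
    rw [← sq_abs]; exact pow_le_pow_left₀ (abs_nonneg _) (hg_bd n x) 2
  obtain ⟨M, hM⟩ := isCompact_Icc.exists_bound_of_continuousOn
    (Real.continuous_mul_log.continuousOn (s := Icc (0 : ℝ) ((3 * Bf) ^ 2)))
  have hA : Tendsto (fun n => ∫ φ, g n φ ^ 2 * Real.log (g n φ ^ 2) ∂ν) atTop
      (𝓝 (∫ φ, f φ ^ 2 * Real.log (f φ ^ 2) ∂ν)) := by
    refine tendsto_integral_of_dominated_convergence (fun _ => M) ?_ (integrable_const M) ?_ ?_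
    · exact fun n =>
        (Real.continuous_mul_log.comp ((hgs n).continuous.pow 2)).aestronglyMeasurable
    · exact fun n => Eventually.of_forall fun φ => hM _ ⟨sq_nonneg _, hg2le n φ⟩
    · exact Eventually.of_forall fun φ =>
        (Real.continuous_mul_log.tendsto _).comp ((hg_tend φ).pow 2)
  have hmean : Tendsto (fun n => ∫ φ, g n φ ^ 2 ∂ν) atTop (𝓝 (∫ φ, f φ ^ 2 ∂ν)) := by
    refine tendsto_integral_of_dominated_convergence (fun _ => (3 * Bf) ^ 2) ?_
      (integrable_const _) ?_ ?_
    · exact fun n => ((hgs n).continuous.pow 2).aestronglyMeasurable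
    · exact fun n => Eventually.of_forall fun φ => by
        rw [Real.norm_eq_abs, abs_of_nonneg (sq_nonneg _)]; exact hg2le n φ
    · exact Eventually.of_forall fun φ => (hg_tend φ).pow 2
  have hB : Tendsto (fun n => (∫ φ, g n φ ^ 2 ∂ν) * Real.log (∫ φ, g n φ ^ 2 ∂ν)) atTop
      (𝓝 ((∫ φ, f φ ^ 2 ∂ν) * Real.log (∫ φ, f φ ^ 2 ∂ν))) :=
    (Real.continuous_mul_log.tendsto _).comp hmean
  ---------------------------------------------------------------- the energy side
  have hQ : ∀ (h : EuclideanSpace ℝ (Fin N) → ℝ) φ,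
      ⟪gradient h φ, Matrix.toEuclideanLin (D.Cdot 0) (gradient h φ)⟫ =
        ∑ k, ∑ l, D.Cdot 0 k l * (fderiv ℝ h φ (EuclideanSpace.single k 1) *
          fderiv ℝ h φ (EuclideanSpace.single l 1)) := fun h φ => by
    rw [inner_toEuclideanLin_self']
    simp only [gradient_apply_single']
  have hdgc : ∀ n (k : Fin N), Continuous fun x => fderiv ℝ (g n) x (EuclideanSpace.single k 1) :=
    fun n k => (ContinuousLinearMap.apply ℝ ℝ (EuclideanSpace.single k 1)).continuous.comp
      ((hgs n).continuous_fderiv (by simp))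
  have hC : Tendsto (fun n => ∫ φ, ⟪gradient (g n) φ, Matrix.toEuclideanLin (D.Cdot 0)
      (gradient (g n) φ)⟫ ∂ν) atTop
      (𝓝 (∫ φ, ⟪gradient f φ, Matrix.toEuclideanLin (D.Cdot 0) (gradient f φ)⟫ ∂ν)) := by
    simp only [hQ]
    refine tendsto_integral_of_dominated_convergence
      (fun _ => ∑ k : Fin N, ∑ l : Fin N, |D.Cdot 0 k l| * ((3 * Bd) * (3 * Bd))) ?_
      (integrable_const _) ?_ ?_
    · exact fun n => (continuous_finsetSum _ fun k _ => continuous_finsetSum _ fun l _ =>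
        continuous_const.mul ((hdgc n k).mul (hdgc n l))).aestronglyMeasurable
    · refine fun n => Eventually.of_forall fun φ => ?_
      rw [Real.norm_eq_abs]
      refine (Finset.abs_sum_le_sum_abs _ _).trans (Finset.sum_le_sum fun k _ =>
        (Finset.abs_sum_le_sum_abs _ _).trans (Finset.sum_le_sum fun l _ => ?_))
      rw [abs_mul, abs_mul]
      exact mul_le_mul_of_nonneg_left (mul_le_mul (hdg_bd n φ k) (hdg_bd n φ l) (abs_nonneg _)
        (by positivity)) (abs_nonneg _)
    · exact Eventually.of_forall fun φ => tendsto_finsetSum _ fun k _ =>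
        tendsto_finsetSum _ fun l _ => ((hdg_tend φ _).mul (hdg_tend φ _)).const_mul _
  ---------------------------------------------------------------- pass to the limit
  exact le_of_tendsto_of_tendsto' (hA.sub hB) (hC.const_mul (2 * I)) hstep

end Main

end Polchinski

end Literature.Analysis.FunctionSpaces

end
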